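import Summits.QuantumFields.YangMills.Theorems.ColdStartUniversalityLatticeLangevinPointwiseMixingLoopStrings
import Summits.QuantumFields.YangMills.Theorems.ColdStartUniversalityUniformColdStartMixingFixedCutoffBlockLoopStringCesaro
import HarnessLib

/-!
# Route `ColdStartUniversality` (fixed-cut-off package, Bakry–Émery side, GRADIENT half): the rung's CONCLUSION SHAPE (Cesàro mean in physical
# time of block-averaged loop strings) from EVERY deterministic start, with NO burn-in and a `T_c` free of the volume and of `ρ^(-1/2)`

Helper file (seat `ym-line-csu-p1`, g29; `--supports stmt-QuantumFields-24809`).  The every-start exponential mixing of block loop strings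
(`blockLoopString_pointwiseMixing_fixedCutoff_window`: `|E[∏W̄(U_t)] − μ_K(∏W̄)| ≤ C_K e^(−ρ_K t)`, `C_K = 4√6·π·Σ_k(R_k+T_k)·√(L_K³/#B)`,
`ρ_K = 1 − 6/(γε_K)`) fed into the Cesàro bookkeeping of the rung (`abs_sub_inv_mul_integral_le_of_le`, `inv_mul_integral_comp_div`):
* ★★★ `everyStart_blockLoopString_cesaro_fixedCutoff_window` — for `6 < γε_K`, `T_c = 1 + |log(2C_K/δ)|/ρ_K`, every strong solution at `β'_K`
  from ANY deterministic start and every physical `T ≥ ε_K·(T_c + 4T_c/δ)`:  `|∫ ∏_k W̄_(B,k) dμ_K − T⁻¹ ∫₀ᵀ E[∏_k W̄_(B,k)(U(s/ε_K))] ds| ≤ δ`.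
Compared with `coldStart_blockLoopString_cesaro_fixedCutoff_window` (entropy route): no burn-in `2 +`, and `C_K` carries neither the entropy
constant `366|β'_K|+3` nor `ρ_K^(-1/2)`; for `B` a fixed fraction of the torus `T_c` is volume-free.
THEOREMS ONLY, no definition, no sorry.  [cite: BakryGentilLedoux2014, Thm 3.3.18; ShenZhuZhu2022 §4 Theorem 4.2, Corollary 4.4].
HONEST FRAMING: a WINDOW statement at fixed cut-off (`6 < γε_K` fails as `ε_K → 0` at fixed `γ`); the physical time threshold is `ε_K·T_c`,
i.e. it is NOT uniform in `K` in the sense of `UniformColdStartMixing` (stmt-24809, aside), which is NOT restated or weakened here; the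
Yang–Mills mass gap is NOT proved.
-/

set_option autoImplicit false

noncomputable section

namespace Summit.QuantumFields.YangMills.Theorems.ColdStartUniversality

open MeasureTheory ProbabilityTheory Finset Filter Set
open scoped BigOperators NNReal ENNReal Topology Matrix
open Literature.Probability.Process Literature.MathematicalPhysics.QuantumFieldTheory
open Literature.MathematicalPhysics.QuantumLattice (fundamentalRep fundamentalLatticeRep continuous_fundamentalRep)
open Literature.MathematicalPhysics.QuantumFieldTheory.Balaban1983to89

/-- ★★★ **The rung's conclusion shape from EVERY deterministic start — Cesàro mean in physical time, no burn-in, `T_c` volume-free for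
macroscopic blocks.**  For `6 < γε_K`, `ρ_K = 1 − 6/(γε_K)`, `C_K = 4√6·π·Σ_k(R_k+T_k)·√(L_K³/#B)`, `T_c = 1 + |log(2C_K/δ)|/ρ_K`: for every
strong solution at `β'_K` from a deterministic start `z` and every physical `T ≥ ε_K·(T_c + 4T_c/δ)`,
`|∫ ∏_k W̄_(B,k) dμ_K − T⁻¹ ∫₀ᵀ E[∏_k W̄_(B,k)(U(s/ε_K))] ds| ≤ δ`. [cite: BakryGentilLedoux2014, Thm 3.3.18; ShenZhuZhu2022 §4 Corollary 4.4] -/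
theorem everyStart_blockLoopString_cesaro_fixedCutoff_window (F : T3ContinuumYM3Torus.T3Family) (γ : ℝ) (K : ℕ) (hK : 6 < γ * (F.P K).eps)
    (B : Finset (Site 3 ((F.P K).sitesPerDir 0))) (hB : B.Nonempty) (m : ℕ) (i j : Fin m → Fin 3) (R T : Fin m → ℕ) (hRT : 0 < ∑ k, (R k + T k))
    (z : GaugeConfig 3 ((F.P K).sitesPerDir 0) (Matrix.specialUnitaryGroup (Fin 2) ℂ))
    {Ω : Type} [MeasurableSpace Ω] {P : Measure Ω} [IsProbabilityMeasure P]
    {W : ℝ≥0 → Ω → (Edge 3 ((F.P K).sitesPerDir 0) × NoiseIdx 2 → ℝ)} (hW : IsFlatBrownian W P)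
    {U : ℝ≥0 → Ω → GaugeConfig 3 ((F.P K).sitesPerDir 0) (Matrix.specialUnitaryGroup (Fin 2) ℂ)} (hU0 : ∀ ω, U 0 ω = z)
    (hU : (latticeLangevinDynamics (fundamentalLatticeRep 2) ((γ * (F.P K).eps)⁻¹ / 2)).IsSolution (fundamentalRep (Fin 2)) hW.natFiltration P W U)
    {δ : ℝ} (hδ : 0 < δ) {Tphys : ℝ}
    (hT : (F.P K).eps * ((1 + |Real.log (2 * (4 * Real.sqrt 6 * Real.pi * (∑ k : Fin m, ((R k : ℝ) + T k)) * Real.sqrt (((((((F.P K).sitesPerDir 0) : ℕ) : ℝ)) ^ 3) / (B.card : ℝ))) / δ)| / (1 - 6 / (γ * (F.P K).eps))) + 4 * (1 + |Real.log (2 * (4 * Real.sqrt 6 * Real.pi * (∑ k : Fin m, ((R k : ℝ) + T k)) * Real.sqrt (((((((F.P K).sitesPerDir 0) : ℕ) : ℝ)) ^ 3) / (B.card : ℝ))) / δ)| / (1 - 6 / (γ * (F.P K).eps))) / δ) ≤ Tphys) :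
    |(∫ V, (∏ k : Fin m, (((B.card : ℝ))⁻¹ * ∑ x ∈ B, wilsonLoop (fundamentalRep (Fin 2)) x (i k) (j k) (R k) (T k) V)) ∂(wilsonMeasure (d := 3) (L := ((F.P K).sitesPerDir 0)) (fundamentalRep (Fin 2)) ((γ * (F.P K).eps)⁻¹ / 2))) -
        Tphys⁻¹ * ∫ s in (0 : ℝ)..Tphys, (∫ ω, (∏ k : Fin m, (((B.card : ℝ))⁻¹ * ∑ x ∈ B, wilsonLoop (fundamentalRep (Fin 2)) x (i k) (j k) (R k) (T k) (U (s / (F.P K).eps).toNNReal ω))) ∂P)| ≤ δ := by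
  classical
  have he : 0 < (F.P K).eps := (F.P K).eps_pos
  have hγε : 0 < γ * (F.P K).eps := lt_trans (by norm_num) hK
  have hρ : 0 < (1 - 6 / (γ * (F.P K).eps)) := by rw [sub_pos, div_lt_one hγε]; exact hK
  haveI := secondCountableTopology_su2
  haveI := borelSpace_config ((F.P K).sitesPerDir 0)
  haveI : IsProbabilityMeasure (wilsonMeasure (d := 3) (L := ((F.P K).sitesPerDir 0)) (fundamentalRep (Fin 2)) ((γ * (F.P K).eps)⁻¹ / 2)) :=
    isProbabilityMeasure_wilsonMeasure (d := 3) (L := ((F.P K).sitesPerDir 0)) (fundamentalRep (Fin 2)) (continuous_fundamentalRep (Fin 2)) _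
  obtain ⟨hcont, hbd⟩ := continuous_and_abs_le_one_blockLoopString m i j R T B hB
  -- the lattice-time integrand
  set g : ℝ → ℝ := fun t => ∫ ω, (∏ k : Fin m, (((B.card : ℝ))⁻¹ * ∑ x ∈ B, wilsonLoop (fundamentalRep (Fin 2)) x (i k) (j k) (R k) (T k) (U t.toNNReal ω))) ∂P with hg
  obtain ⟨hgb, hgi⟩ := integrand_bound_and_intervalIntegrable hW hU hcont.measurable hbd
  set e : ℝ := ∫ V, (∏ k : Fin m, (((B.card : ℝ))⁻¹ * ∑ x ∈ B, wilsonLoop (fundamentalRep (Fin 2)) x (i k) (j k) (R k) (T k) V)) ∂(wilsonMeasure (d := 3) (L := ((F.P K).sitesPerDir 0)) (fundamentalRep (Fin 2)) ((γ * (F.P K).eps)⁻¹ / 2)) with hedef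
  have he1 : |e| ≤ 1 := by
    have h := norm_integral_le_of_norm_le_const (μ := (wilsonMeasure (d := 3) (L := ((F.P K).sitesPerDir 0)) (fundamentalRep (Fin 2)) ((γ * (F.P K).eps)⁻¹ / 2))) (ae_of_all _ fun V => (show ‖(∏ k : Fin m, (((B.card : ℝ))⁻¹ * ∑ x ∈ B, wilsonLoop (fundamentalRep (Fin 2)) x (i k) (j k) (R k) (T k) V))‖ ≤ 1 by rw [Real.norm_eq_abs]; exact hbd V))
    rw [Real.norm_eq_abs, probReal_univ, mul_one] at h
    exact h
  obtain ⟨C, hC⟩ : ∃ C : ℝ, 4 * Real.sqrt 6 * Real.pi * (∑ k : Fin m, ((R k : ℝ) + T k)) * Real.sqrt (((((((F.P K).sitesPerDir 0) : ℕ) : ℝ)) ^ 3) / (B.card : ℝ)) = C := ⟨_, rfl⟩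
  set Tc : ℝ := (1 + |Real.log (2 * (4 * Real.sqrt 6 * Real.pi * (∑ k : Fin m, ((R k : ℝ) + T k)) * Real.sqrt (((((((F.P K).sitesPerDir 0) : ℕ) : ℝ)) ^ 3) / (B.card : ℝ))) / δ)| / (1 - 6 / (γ * (F.P K).eps))) with hTc
  rw [hC] at hTc
  have hTc1 : 1 ≤ Tc := by rw [hTc]; linarith [div_nonneg (abs_nonneg (Real.log (2 * C / δ))) hρ.le]
  have hTcpos : 0 < Tc := by linarith
  have hS : (0 : ℝ) < (B.card : ℝ) := by exact_mod_cast hB.card_pos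
  have hRT' : (0 : ℝ) < (∑ k : Fin m, ((R k : ℝ) + T k)) := by
    have h' : ((∑ k, (R k + T k) : ℕ) : ℝ) = (∑ k : Fin m, ((R k : ℝ) + T k)) := by push_cast; rfl
    rw [← h']; exact_mod_cast hRT
  have hLpos : (0 : ℝ) < ((((((F.P K).sitesPerDir 0) : ℕ) : ℝ)) ^ 3) := by
    have : 0 < ((F.P K).sitesPerDir 0) := Nat.pos_of_ne_zero (NeZero.ne _)
    positivity
  have hCpos : 0 < C := by
    rw [← hC]
    refine mul_pos (mul_pos (mul_pos (mul_pos (by norm_num) (Real.sqrt_pos.2 (by norm_num))) Real.pi_pos) hRT') (Real.sqrt_pos.2 (div_pos hLpos hS))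
  -- pointwise mixing after `T_c` (every start, no burn-in)
  have hmix : ∀ t : ℝ, Tc ≤ t → |e - g t| ≤ δ / 2 := by
    intro t ht
    have ht0 : 0 ≤ t := by linarith
    have hpt := blockLoopString_pointwiseMixing_fixedCutoff_window F γ K hK m i j R T B hB t.toNNReal z Ω P W hW U hU0 hU
    rw [hC, Real.coe_toNNReal _ ht0] at hpt
    have hu : Real.log (2 * C / δ) ≤ (1 - 6 / (γ * (F.P K).eps)) * t := by
      have h1 : |Real.log (2 * C / δ)| / (1 - 6 / (γ * (F.P K).eps)) ≤ t - 1 := by rw [hTc] at ht; linarith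
      rw [div_le_iff₀ hρ] at h1
      nlinarith [le_abs_self (Real.log (2 * C / δ)), hρ.le, abs_nonneg (Real.log (2 * C / δ))]
    have hexp : Real.exp (-((1 - 6 / (γ * (F.P K).eps)) * t)) ≤ δ / (2 * C) := by
      have h1 : Real.exp (-((1 - 6 / (γ * (F.P K).eps)) * t)) ≤ Real.exp (-Real.log (2 * C / δ)) := Real.exp_le_exp.2 (by linarith)
      rw [Real.exp_neg (Real.log (2 * C / δ)), Real.exp_log (by positivity), inv_div] at h1
      exact h1
    have hfin : C * Real.exp (-((1 - 6 / (γ * (F.P K).eps)) * t)) ≤ δ / 2 := by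
      calc C * Real.exp (-((1 - 6 / (γ * (F.P K).eps)) * t)) ≤ C * (δ / (2 * C)) := mul_le_mul_of_nonneg_left hexp hCpos.le
        _ = δ / 2 := by field_simp
    rw [abs_sub_comm]
    exact hpt.trans hfin
  -- Cesàro in lattice time, then the physical time change
  have hTphys : 0 < Tphys := lt_of_lt_of_le (by positivity) hT
  set T' : ℝ := Tphys / (F.P K).eps with hT'
  have hT'ge : Tc + 4 * Tc / δ ≤ T' := by
    rw [hT', le_div_iff₀ he]; linarith
  have hlat := abs_sub_inv_mul_integral_le_of_le hTcpos hδ le_rfl he1 hgb hgi hmix hT'ge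
  have hT'ne : T' ≠ 0 := by
    have : 0 < T' := lt_of_lt_of_le hTcpos (le_trans (le_add_of_nonneg_right (by positivity)) hT'ge)
    exact this.ne'
  have hchange := inv_mul_integral_comp_div g he.ne' hT'ne
  have eT : (F.P K).eps * T' = Tphys := by rw [hT']; field_simp
  rw [eT] at hchange
  rw [hchange]
  exact hlat

end Summit.QuantumFields.YangMills.Theorems.ColdStartUniversality
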